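import Mathlib
import Summits.NavierStokesRegularity.FluidComputer.AbcLatticePairingBound
import Summits.NavierStokesRegularity.FluidComputer.AbcLinearisedLattice
import HarnessLib

/-!
# The pairing bound `s = √2` on the whole graph domain of the ABC lattice operator
# (ASSEMBLY obligation (A4), pairing half, of `HOME/instab4/KERNEL-CHAIN.md` — the density step;
# instab4 g5 — implementation 2 of the X0 chain, cell `ns-blowup`, 2026-08-26)

HONEST FRAMING (human ruling D-0035): nothing here is a claim about Navier–Stokes blow-up.
WHAT THIS IS NOT: not NS evidence; MODEL lane (linearisation of forced Navier–Stokes about the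
exact steady ABC state `U = Torus.abcFlow 1 1 1`, force `f = νU`). No certificate is moved by this
file. `AbcLatticePairingBound.abs_re_sum_inner_crossForm_le` proved the certificates' analytic input
`|Re Σ_k ⟪c(k), X c(k)⟫| ≤ √2 Σ_k ‖c(k)‖²`, `X c(k) = Σ_{s∈{±e_j}} Û(s) × (i(k−s) × c(k−s) − c(k−s))`,
for FINITELY SUPPORTED transversal `c` (every Galerkin section). The abstract exclusion theorem
`SkewCutGalerkinTailForm.not_eigenvalue_of_structure` consumes it (hypothesis `hpair`) on the whole
orthogonal complement of the head, i.e. for every `c` in the graph domain of the first-order part —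
NOT only on sections. This file performs that density step on the lattice, by cube-free truncation:

* §1 `inner_crossForm_eq_sum_pairTerm` — per frequency, for transversal `c(k)`, the pairing is a
  six-term sum of FACTORED pair terms
  `⟪c(k), X c(k)⟫ = Σ_s −i·[((k−s)·Û(s)) ⟪c(k), c(k−s)⟫ + (s·c(k−s)) ⟪c(k), Û(s)⟫]`
  (transport + stretch, `AbcLatticePairingSplit.inner_crossForm_eq`); `norm_pairTerm_le` — each pair
  term is `≤ 9 ⟨k−s⟩ ‖Û(s)‖ ‖c(k)‖ ‖c(k−s)‖` (first order).
* §2 `abs_re_tsum_inner_crossForm_le` — **(A4) on the graph domain**: if `k·c(k) = 0 ∀k` and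
  `Σ_k (1+|k|²) ‖c(k)‖² < ∞` (an `H¹` family; in particular every `H²`/graph-domain family), then
  `k ↦ ⟪c(k), X c(k)⟫` is summable and `|Re Σ_k ⟪c(k), X c(k)⟫| ≤ √2 · Σ_k ‖c(k)‖²`
  (truncations `c·1_F` are finitely supported and transversal; the truncated pairings are the partial
  sums of the absolutely summable pair-term family over `{(k, s) : k ∈ F, k − s ∈ F}`, which exhausts
  `ℤ³ × {±e_j}` as `F ↑ ℤ³`; the finite bound passes to the limit).

Mathlib + the files named (`AbcLinearisedLattice.norm_sq_abcCoeff_abcDir` for `‖Û(±e_j)‖² = 1/2`);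
no new definitions, no named facts.
-/

noncomputable section

open scoped BigOperators ComplexConjugate Matrix Topology
open Filter Set Function MeasureTheory UnitAddTorus

namespace Summit.NavierStokesRegularity.FluidComputer.AbcLatticePairingDomain

open Literature.Analysis.FunctionSpaces Literature.Analysis.FunctionSpaces.Torus
open Literature.Analysis.FunctionSpaces.EuclideanSpace
open Literature.Analysis.FluidPDE Literature.Analysis.FluidPDE.ScalarFourier
open Literature.Analysis.FluidPDE.SteadyLattice
open AbcLatticeEigenSynthesis AbcLatticePairingSplit AbcLatticePairingBound

/-! ## §1 Factored pair terms and their first-order bound -/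

/-- Factoring the transport + stretch pairing of one frequency pair:
`Σ_p Σ_j conj x_p (a_j (2πi (k−s)_j) e_p + e_j (2πi s_j) a_p) = 2πi((k−s)·a)⟪x,e⟫ + 2πi(s·e)⟪x,a⟫`.
[folklore] -/
theorem pairTerm_eq (a x e : EuclideanSpace ℂ (Fin 3)) (k s : Fin 3 → ℤ) :
    ∑ pp : Fin 3, ∑ j : Fin 3, conj (x pp) *
        (a j * (2 * Real.pi * Complex.I * (((k - s) j : ℤ) : ℂ)) * e pp +
          e j * (2 * Real.pi * Complex.I * ((s j : ℤ) : ℂ)) * a pp) =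
      2 * Real.pi * Complex.I * (∑ j : Fin 3, (((k - s) j : ℤ) : ℂ) * a j) * inner ℂ x e +
        2 * Real.pi * Complex.I * (∑ j : Fin 3, ((s j : ℤ) : ℂ) * e j) * inner ℂ x a := by
  rw [inner_fin3_eq_sum, inner_fin3_eq_sum,
    Finset.mul_sum Finset.univ (fun pp => conj (x pp) * e pp),
    Finset.mul_sum Finset.univ (fun pp => conj (x pp) * a pp), ← Finset.sum_add_distrib]
  refine Finset.sum_congr rfl fun pp _ => ?_
  rw [Finset.mul_sum Finset.univ (fun j => (((k - s) j : ℤ) : ℂ) * a j) (2 * Real.pi * Complex.I),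
    Finset.sum_mul, Finset.mul_sum Finset.univ (fun j => ((s j : ℤ) : ℂ) * e j) (2 * Real.pi * Complex.I),
    Finset.sum_mul, ← Finset.sum_add_distrib]
  refine Finset.sum_congr rfl fun j _ => ?_
  ring

/-- **The pairing per frequency as six factored pair terms.** For `c(k)` transversal:
`⟪c(k), Σ_s Û(s) × (i(k−s) × c(k−s) − c(k−s))⟫ = Σ_s −i·[((k−s)·Û(s)) ⟪c(k), c(k−s)⟫ + (s·c(k−s)) ⟪c(k), Û(s)⟫]`
(any `A, B, C`). -/
theorem inner_crossForm_eq_sum_pairTerm (A B C : ℝ) (c : (Fin 3 → ℤ) → EuclideanSpace ℂ (Fin 3))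
    (k : Fin 3 → ℤ) (hck : (∑ jj : Fin 3, ((k jj : ℤ) : ℂ) * (c k) jj) = 0) :
    (inner ℂ (c k) (∑ s ∈ Torus.abcFreq, (WithLp.toLp 2 (crossProduct (WithLp.ofLp (Torus.abcCoeff A B C s))
          (Complex.I • crossProduct (fun j => (((k - s) j : ℤ) : ℂ)) (WithLp.ofLp (c (k - s))) -
            WithLp.ofLp (c (k - s)))) : EuclideanSpace ℂ (Fin 3))) : ℂ) =
      ∑ s ∈ Torus.abcFreq, -Complex.I *
        ((∑ j : Fin 3, (((k - s) j : ℤ) : ℂ) * Torus.abcCoeff A B C s j) * inner ℂ (c k) (c (k - s)) +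
          (∑ j : Fin 3, ((s j : ℤ) : ℂ) * c (k - s) j) * inner ℂ (c k) (Torus.abcCoeff A B C s)) := by
  rw [inner_crossForm_eq A B C c k hck, Finset.mul_sum]
  refine Finset.sum_congr rfl fun s _ => ?_
  rw [pairTerm_eq]
  have hπ : (Real.pi : ℂ) ≠ 0 := by exact_mod_cast Real.pi_ne_zero
  field_simp

/-- The ABC shell coefficients of `abcFlow 1 1 1` have norm at most one (`‖Û(±e_j)‖² = 1/2`,
`AbcLinearisedLattice.norm_sq_abcCoeff_abcDir`). -/
theorem norm_abcCoeff_one_le (y : Fin 3 × Bool) : ‖Torus.abcCoeff 1 1 1 (Torus.abcDir y)‖ ≤ 1 := by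
  have h := AbcLinearisedLattice.norm_sq_abcCoeff_abcDir 1 1 1 y
  have hamp : (Torus.abcAmp 1 1 1 y.1) ^ 2 ≤ 1 := by
    obtain ⟨j, b⟩ := y
    fin_cases j <;> simp [Torus.abcAmp]
  nlinarith [norm_nonneg (Torus.abcCoeff 1 1 1 (Torus.abcDir y))]

/-- **First-order bound of a pair term**: for `s = ±e_m`,
`‖−i·[((k−s)·a) ⟪x, e⟫ + (s·e) ⟪x, a⟫]‖ ≤ 9 ⟨k−s⟩ ‖a‖ ‖x‖ ‖e‖` (`|m·v| ≤ 3⟨m⟩‖v‖`,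
`⟨±e_m⟩ = √2 ≤ 2 ≤ 2⟨k−s⟩`). [folklore] -/
theorem norm_pairTerm_le (a x e : EuclideanSpace ℂ (Fin 3)) (k : Fin 3 → ℤ) (y : Fin 3 × Bool) :
    ‖-Complex.I * ((∑ j : Fin 3, (((k - Torus.abcDir y) j : ℤ) : ℂ) * a j) * inner ℂ x e +
        (∑ j : Fin 3, ((Torus.abcDir y j : ℤ) : ℂ) * e j) * inner ℂ x a)‖ ≤
      9 * sobolevWeight 1 (k - Torus.abcDir y) * ‖a‖ * ‖x‖ * ‖e‖ := by
  set s := Torus.abcDir y with hs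
  have hw1 : 1 ≤ sobolevWeight 1 (k - s) := one_le_sobolevWeight zero_le_one _
  have hws : sobolevWeight 1 s ≤ 2 := by
    rw [hs, sobolevWeight, Torus.freqNormSq_abcDir]
    have : ((1 : ℝ) + 1) ^ ((1 : ℝ) / 2) = Real.sqrt 2 := by rw [Real.sqrt_eq_rpow]; norm_num
    rw [this]
    have h2 : Real.sqrt 2 ≤ Real.sqrt 4 := Real.sqrt_le_sqrt (by norm_num)
    have h4 : Real.sqrt 4 = 2 := by
      rw [show (4 : ℝ) = 2 ^ 2 by norm_num, Real.sqrt_sq (by norm_num : (0 : ℝ) ≤ 2)]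
    linarith
  have h1 : ‖(∑ j : Fin 3, (((k - s) j : ℤ) : ℂ) * a j) * inner ℂ x e‖ ≤
      3 * sobolevWeight 1 (k - s) * ‖a‖ * (‖x‖ * ‖e‖) := by
    rw [norm_mul]
    have h0 : 0 ≤ 3 * sobolevWeight 1 (k - s) * ‖a‖ :=
      mul_nonneg (mul_nonneg (by norm_num) (sobolevWeight_pos 1 _).le) (norm_nonneg _)
    exact mul_le_mul (norm_kdot_le (k - s) a) (norm_inner_le_norm x e) (norm_nonneg _) h0
  have h2 : ‖(∑ j : Fin 3, ((s j : ℤ) : ℂ) * e j) * inner ℂ x a‖ ≤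
      3 * sobolevWeight 1 s * ‖e‖ * (‖x‖ * ‖a‖) := by
    rw [norm_mul]
    have h0 : 0 ≤ 3 * sobolevWeight 1 s * ‖e‖ :=
      mul_nonneg (mul_nonneg (by norm_num) (sobolevWeight_pos 1 _).le) (norm_nonneg _)
    exact mul_le_mul (norm_kdot_le s e) (norm_inner_le_norm x a) (norm_nonneg _) h0
  have ha := norm_nonneg a; have hx := norm_nonneg x; have he := norm_nonneg e
  calc ‖-Complex.I * ((∑ j : Fin 3, (((k - s) j : ℤ) : ℂ) * a j) * inner ℂ x e +
          (∑ j : Fin 3, ((s j : ℤ) : ℂ) * e j) * inner ℂ x a)‖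
        = ‖(∑ j : Fin 3, (((k - s) j : ℤ) : ℂ) * a j) * inner ℂ x e +
          (∑ j : Fin 3, ((s j : ℤ) : ℂ) * e j) * inner ℂ x a‖ := by
          rw [norm_mul, norm_neg, Complex.norm_I, one_mul]
    _ ≤ 3 * sobolevWeight 1 (k - s) * ‖a‖ * (‖x‖ * ‖e‖) + 3 * sobolevWeight 1 s * ‖e‖ * (‖x‖ * ‖a‖) :=
          (norm_add_le _ _).trans (add_le_add h1 h2)
    _ ≤ 3 * sobolevWeight 1 (k - s) * ‖a‖ * (‖x‖ * ‖e‖) +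
          3 * (2 * sobolevWeight 1 (k - s)) * ‖e‖ * (‖x‖ * ‖a‖) := by
          gcongr
          linarith
    _ = 9 * sobolevWeight 1 (k - s) * ‖a‖ * ‖x‖ * ‖e‖ := by ring

/-! ## §2 (A4) on the graph domain -/

/-- **(A4) PAIRING BOUND ON THE GRAPH DOMAIN.** For `U = Torus.abcFlow 1 1 1` and every transversal
Cartesian family `c : ℤ³ → ℂ³` (`k·c(k) = 0 ∀k`) with `Σ_k (1 + |k|²)‖c(k)‖² < ∞`, the pairing with the
first-order part `X c(k) = Σ_{s∈{±e_j}} Û(s) × (i(k−s) × c(k−s) − c(k−s))` of the certifiers' operator is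
absolutely convergent and `|Re Σ_k ⟪c(k), X c(k)⟫| ≤ √2 · Σ_k ‖c(k)‖²` — the form in which hypothesis
`hpair` of `SkewCutGalerkinTailForm.not_eigenvalue_of_structure` is consumed (all of the head's
orthogonal complement inside the graph domain, not only Galerkin sections). Density step over
`AbcLatticePairingBound.abs_re_sum_inner_crossForm_le`. MODEL statement; not NS. -/
theorem abs_re_tsum_inner_crossForm_le (c : (Fin 3 → ℤ) → EuclideanSpace ℂ (Fin 3))
    (hdiv : ∀ k : Fin 3 → ℤ, (∑ jj : Fin 3, ((k jj : ℤ) : ℂ) * (c k) jj) = 0)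
    (hc : Summable fun k : Fin 3 → ℤ => (1 + freqNormSq k) * ‖c k‖ ^ 2) :
    Summable (fun k : Fin 3 → ℤ => (inner ℂ (c k) (∑ s ∈ Torus.abcFreq,
        (WithLp.toLp 2 (crossProduct (WithLp.ofLp (Torus.abcCoeff 1 1 1 s))
          (Complex.I • crossProduct (fun j => (((k - s) j : ℤ) : ℂ)) (WithLp.ofLp (c (k - s))) -
            WithLp.ofLp (c (k - s)))) : EuclideanSpace ℂ (Fin 3))) : ℂ)) ∧
    |(∑' k : Fin 3 → ℤ, (inner ℂ (c k) (∑ s ∈ Torus.abcFreq,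
        (WithLp.toLp 2 (crossProduct (WithLp.ofLp (Torus.abcCoeff 1 1 1 s))
          (Complex.I • crossProduct (fun j => (((k - s) j : ℤ) : ℂ)) (WithLp.ofLp (c (k - s))) -
            WithLp.ofLp (c (k - s)))) : EuclideanSpace ℂ (Fin 3))) : ℂ)).re| ≤
      Real.sqrt 2 * ∑' k : Fin 3 → ℤ, ‖c k‖ ^ 2 := by
  classical
  set a := Torus.abcCoeff 1 1 1 with ha
  -- the factored pair term, indexed by `(k, y)` with `s = abcDir y`
  set q : (Fin 3 → ℤ) × (Fin 3 × Bool) → ℂ := fun p => -Complex.I *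
    ((∑ j : Fin 3, (((p.1 - Torus.abcDir p.2) j : ℤ) : ℂ) * a (Torus.abcDir p.2) j) *
        inner ℂ (c p.1) (c (p.1 - Torus.abcDir p.2)) +
      (∑ j : Fin 3, ((Torus.abcDir p.2 j : ℤ) : ℂ) * c (p.1 - Torus.abcDir p.2) j) *
        inner ℂ (c p.1) (a (Torus.abcDir p.2))) with hq
  -- ℓ² bookkeeping
  have hc0 : Summable fun k : Fin 3 → ℤ => ‖c k‖ ^ 2 := by
    refine Summable.of_nonneg_of_le (fun k => by positivity) (fun k => ?_) hc
    have := one_le_one_add_freqNormSq k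
    nlinarith [sq_nonneg ‖c k‖]
  -- (1) absolute summability of the pair terms
  have hdom : ∀ p : (Fin 3 → ℤ) × (Fin 3 × Bool), ‖q p‖ ≤
      (9 / 2) * (‖c p.1‖ ^ 2 + (1 + freqNormSq (p.1 - Torus.abcDir p.2)) * ‖c (p.1 - Torus.abcDir p.2)‖ ^ 2) := by
    rintro ⟨k, y⟩
    have h := norm_pairTerm_le (a (Torus.abcDir y)) (c k) (c (k - Torus.abcDir y)) k y
    have hU : ‖a (Torus.abcDir y)‖ ≤ 1 := norm_abcCoeff_one_le y
    set w := sobolevWeight 1 (k - Torus.abcDir y) with hw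
    have hw0 : 0 ≤ w := (sobolevWeight_pos 1 _).le
    have hwsq : w ^ 2 = 1 + freqNormSq (k - Torus.abcDir y) := sobolevWeight_one_sq _
    have hx := norm_nonneg (c k); have he := norm_nonneg (c (k - Torus.abcDir y))
    calc ‖q (k, y)‖ ≤ 9 * w * ‖a (Torus.abcDir y)‖ * ‖c k‖ * ‖c (k - Torus.abcDir y)‖ := h
      _ ≤ 9 * w * 1 * ‖c k‖ * ‖c (k - Torus.abcDir y)‖ := by gcongr
      _ ≤ (9 / 2) * (‖c k‖ ^ 2 + w ^ 2 * ‖c (k - Torus.abcDir y)‖ ^ 2) := by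
          nlinarith [sq_nonneg (‖c k‖ - w * ‖c (k - Torus.abcDir y)‖)]
      _ = (9 / 2) * (‖c k‖ ^ 2 + (1 + freqNormSq (k - Torus.abcDir y)) * ‖c (k - Torus.abcDir y)‖ ^ 2) := by
          rw [hwsq]
  have hgsum : Summable fun p : (Fin 3 → ℤ) × (Fin 3 × Bool) =>
      (9 / 2) * (‖c p.1‖ ^ 2 + (1 + freqNormSq (p.1 - Torus.abcDir p.2)) * ‖c (p.1 - Torus.abcDir p.2)‖ ^ 2) := by
    refine (summable_prod_of_nonneg fun p => ?_).mpr ⟨fun k => Summable.of_finite, ?_⟩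
    · have := freqNormSq_nonneg (p.1 - Torus.abcDir p.2)
      positivity
    · simp_rw [tsum_fintype]
      refine summable_sum fun y _ => Summable.mul_left _ (hc0.add ?_)
      exact hc.comp_injective (sub_left_injective (b := Torus.abcDir y))
  have hqsum : Summable q := Summable.of_norm_bounded hgsum hdom
  -- (2) per frequency: the pairing is the sum of the six pair terms (for `c` and its truncations)
  have hpt : ∀ (c' : (Fin 3 → ℤ) → EuclideanSpace ℂ (Fin 3)) (k : Fin 3 → ℤ),
      (∑ jj : Fin 3, ((k jj : ℤ) : ℂ) * (c' k) jj) = 0 →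
      (inner ℂ (c' k) (∑ s ∈ Torus.abcFreq, (WithLp.toLp 2 (crossProduct (WithLp.ofLp (a s))
          (Complex.I • crossProduct (fun j => (((k - s) j : ℤ) : ℂ)) (WithLp.ofLp (c' (k - s))) -
            WithLp.ofLp (c' (k - s)))) : EuclideanSpace ℂ (Fin 3))) : ℂ) =
        ∑ y : Fin 3 × Bool, -Complex.I *
          ((∑ j : Fin 3, (((k - Torus.abcDir y) j : ℤ) : ℂ) * a (Torus.abcDir y) j) *
              inner ℂ (c' k) (c' (k - Torus.abcDir y)) +
            (∑ j : Fin 3, ((Torus.abcDir y j : ℤ) : ℂ) * c' (k - Torus.abcDir y) j) *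
              inner ℂ (c' k) (a (Torus.abcDir y))) := by
    intro c' k hk
    rw [ha, inner_crossForm_eq_sum_pairTerm 1 1 1 c' k hk, Torus.sum_abcFreq]
  -- (3) truncations
  have htrunc : ∀ F : Finset (Fin 3 → ℤ),
      |(∑ p ∈ (F ×ˢ (Finset.univ : Finset (Fin 3 × Bool))).filter
          (fun p => p.1 - Torus.abcDir p.2 ∈ F), q p).re| ≤ Real.sqrt 2 * ∑' k, ‖c k‖ ^ 2 := by
    intro F
    set cF : (Fin 3 → ℤ) → EuclideanSpace ℂ (Fin 3) := fun k => if k ∈ F then c k else 0 with hcF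
    have hcF0 : ∀ k ∉ F, cF k = 0 := fun k hk => by simp [hcF, hk]
    have hcF1 : ∀ k ∈ F, cF k = c k := fun k hk => by simp [hcF, hk]
    have hcFdiv : ∀ k : Fin 3 → ℤ, (∑ jj : Fin 3, ((k jj : ℤ) : ℂ) * (cF k) jj) = 0 := by
      intro k
      by_cases hk : k ∈ F
      · rw [hcF1 k hk]; exact hdiv k
      · rw [hcF0 k hk]; simp
    have hfin := abs_re_sum_inner_crossForm_le cF F hcF0 hcFdiv
    -- the truncated pairing is the partial sum of `q` over the admissible pairs
    have hsumq : (∑ k ∈ F, (inner ℂ (cF k) (∑ s ∈ Torus.abcFreq, (WithLp.toLp 2 (crossProduct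
          (WithLp.ofLp (Torus.abcCoeff 1 1 1 s))
          (Complex.I • crossProduct (fun j => (((k - s) j : ℤ) : ℂ)) (WithLp.ofLp (cF (k - s))) -
            WithLp.ofLp (cF (k - s)))) : EuclideanSpace ℂ (Fin 3))) : ℂ)) =
        ∑ p ∈ (F ×ˢ (Finset.univ : Finset (Fin 3 × Bool))).filter
          (fun p => p.1 - Torus.abcDir p.2 ∈ F), q p := by
      rw [Finset.sum_filter, Finset.sum_product]
      refine Finset.sum_congr rfl fun k hk => ?_
      rw [← ha, hpt cF k (hcFdiv k)]
      refine Finset.sum_congr rfl fun y _ => ?_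
      split_ifs with h
      · rw [hq, hcF1 k hk, hcF1 _ h]
      · rw [hcF0 _ h]
        simp
    have hnorm : ∑ k ∈ F, ‖cF k‖ ^ 2 = ∑ k ∈ F, ‖c k‖ ^ 2 :=
      Finset.sum_congr rfl fun k hk => by rw [hcF1 k hk]
    rw [hsumq, hnorm] at hfin
    refine hfin.trans (mul_le_mul_of_nonneg_left ?_ (Real.sqrt_nonneg _))
    exact hc0.sum_le_tsum F fun k _ => by positivity
  -- (4) the admissible pairs exhaust `ℤ³ × {±e_j}`
  have hΦ : Tendsto (fun F : Finset (Fin 3 → ℤ) => (F ×ˢ (Finset.univ : Finset (Fin 3 × Bool))).filter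
      (fun p => p.1 - Torus.abcDir p.2 ∈ F)) atTop atTop := by
    refine Monotone.tendsto_atTop_atTop (fun F G hFG => ?_) fun b => ?_
    · intro p hp
      simp only [Finset.mem_filter, Finset.mem_product, Finset.mem_univ, and_true] at hp ⊢
      exact ⟨hFG hp.1, hFG hp.2⟩
    · refine ⟨b.image Prod.fst ∪ b.image (fun p => p.1 - Torus.abcDir p.2), fun p hp => ?_⟩
      simp only [Finset.mem_filter, Finset.mem_product, Finset.mem_univ, and_true, Finset.mem_union,
        Finset.mem_image]
      exact ⟨Or.inl ⟨p, hp, rfl⟩, Or.inr ⟨p, hp, rfl⟩⟩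
  have hlim : Tendsto (fun F : Finset (Fin 3 → ℤ) => ∑ p ∈ (F ×ˢ (Finset.univ : Finset (Fin 3 × Bool))).filter
      (fun p => p.1 - Torus.abcDir p.2 ∈ F), q p) atTop (𝓝 (∑' p, q p)) := by
    have h := hqsum.hasSum
    simp only [HasSum, SummationFilter.unconditional_filter] at h
    exact h.comp hΦ
  -- (5) identification of the sum and passage to the limit
  have hfib : ∀ k : Fin 3 → ℤ, (∑' y : Fin 3 × Bool, q (k, y)) =
      (inner ℂ (c k) (∑ s ∈ Torus.abcFreq, (WithLp.toLp 2 (crossProduct (WithLp.ofLp (a s))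
          (Complex.I • crossProduct (fun j => (((k - s) j : ℤ) : ℂ)) (WithLp.ofLp (c (k - s))) -
            WithLp.ofLp (c (k - s)))) : EuclideanSpace ℂ (Fin 3))) : ℂ) := by
    intro k
    rw [tsum_fintype, hpt c k (hdiv k)]
  have hsumk : Summable (fun k : Fin 3 → ℤ => (inner ℂ (c k) (∑ s ∈ Torus.abcFreq,
        (WithLp.toLp 2 (crossProduct (WithLp.ofLp (a s))
          (Complex.I • crossProduct (fun j => (((k - s) j : ℤ) : ℂ)) (WithLp.ofLp (c (k - s))) -
            WithLp.ofLp (c (k - s)))) : EuclideanSpace ℂ (Fin 3))) : ℂ)) := by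
    have h := hqsum.prod
    simp_rw [hfib] at h
    exact h
  refine ⟨hsumk, ?_⟩
  have htot : (∑' k : Fin 3 → ℤ, (inner ℂ (c k) (∑ s ∈ Torus.abcFreq,
        (WithLp.toLp 2 (crossProduct (WithLp.ofLp (a s))
          (Complex.I • crossProduct (fun j => (((k - s) j : ℤ) : ℂ)) (WithLp.ofLp (c (k - s))) -
            WithLp.ofLp (c (k - s)))) : EuclideanSpace ℂ (Fin 3))) : ℂ)) = ∑' p, q p := by
    rw [hqsum.tsum_prod' fun k => Summable.of_finite]
    exact tsum_congr fun k => (hfib k).symm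
  rw [htot]
  have hcont : Tendsto (fun F : Finset (Fin 3 → ℤ) => |(∑ p ∈ (F ×ˢ (Finset.univ : Finset (Fin 3 × Bool))).filter
      (fun p => p.1 - Torus.abcDir p.2 ∈ F), q p).re|) atTop (𝓝 |(∑' p, q p).re|) :=
    ((continuous_abs.comp Complex.continuous_re).tendsto _).comp hlim
  exact le_of_tendsto' hcont htrunc

end Summit.NavierStokesRegularity.FluidComputer.AbcLatticePairingDomain

end
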